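import Mathlib
import Literature.MathematicalPhysics.QuantumLattice.HubbardBandSectorCountingToolbox
import Summits.HubbardSuperconductivity.HubbardSuperconductivity.Theorems.KLProgrammeKLRegimeTwoPointLimitShellGridChord
import Summits.HubbardSuperconductivity.HubbardSuperconductivity.Theorems.KLProgrammeKLRegimeTwoPointLimitShellSectorFibreCount
import HarnessLib

/-!
# Route `KLProgramme` — crux K3 `KLRegimeTwoPointLimit` (stmt-HubbardSuperconductivity-19937), support:
# the four-sector count PER TRANSFER CLASS is `O(1/w)` — no logarithm (DECOMP §2 C1 «Inputs»;
# U5-NOTE §1(b): BGM's Lemma 3.1 `|h|` is the number of classes)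

Cell `gate-hubbard-kl`, seat p1b. On the angular grid `θ_a = w/2 + a w` (`a < N`, `N w = 2π`) of
BGM 2006 App. A2 / the tree's `count_pairs_exists`, with `θ₁` fixed, `W(θ_a) = -(p_μ(θ₁) + p_μ(θ_a))` the
particle–particle transfer of the pair `(θ₁, θ_a)` and `h` the three-point level function `hfun`:

* `klgc_exists_class_count` — there are `w₀, v, K > 0` (depending only on `B`, the margin, `C_δ`) such
  that for every lattice point `2πm`, every dyadic level `w ≤ R ≤ v` and `0 < w ≤ w₀`:
  `#{(a, c) : R/2 < |W(θ_a) - 2πm|_∞ ≤ R, |h(θ₁, θ_a, θ_c)| ≤ C_δ w} ≤ K/w` — uniformly in the class: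
  the Cooper-keyed fibre count `≤ K₁/|W - 2πm|_∞ ≤ 2K₁/R` (`klfc_exists_fibre_count` (i)) times the
  `≤ 4√2πR/(u_min w) + 3` members of the class (`klgc_card_grid_near_point_le`). Summing over the
  `≍ log₂(v/w) ≍ |h|` dyadic classes reproduces the `|h|` of BGM's total; per class there is none.
-/

noncomputable section

-- the tree's namespace `Summit.<Summit>.<Problem>.Theorems` repeats the summit name by design (D-0017)
set_option linter.dupNamespace false

open Real Set MeasureTheory
open Literature.MathematicalPhysics.QuantumLattice
open Literature.MathematicalPhysics.QuantumLattice.BandSectorCounting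

namespace Summit.HubbardSuperconductivity.HubbardSuperconductivity.Theorems
section Main

variable {a b : ℝ} (B : BandBounds a b)
include B

/-- **The four-sector count per Cooper transfer class is `O(1/w)`.** For a margin `η⋆ > 0` and a
threshold `C_δ > 0` there are `w₀, v, K > 0` such that for every level `μ` with `μ ± η⋆` in the range,
every `θ₁`, every grid `N w = 2π` with `0 < w ≤ w₀`, every lattice point `2π(m₀, m₁)` and every dyadic
level `w ≤ R ≤ v`: the pairs `(a, c)` of grid angles with the transfer `W(θ_a) = -(p_μ(θ₁) + p_μ(θ_a))`
in the class `R/2 < |W(θ_a) - 2πm|_∞ ≤ R` and `|h(θ₁, θ_a, θ_c)| ≤ C_δ w` number at most `K/w` —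
uniformly in `R`: no logarithm per class. -/
theorem klgc_exists_class_count {ηs Cδ : ℝ} (hηs : 0 < ηs) (hCδ : 0 < Cδ) :
    ∃ w₀ v K : ℝ, 0 < w₀ ∧ 0 < v ∧ 0 < K ∧
      ∀ (μ : ℝ), a ≤ μ - ηs → μ + ηs ≤ b → ∀ (θ₁ w R : ℝ) (N : ℕ) (m₀ m₁ : ℤ), 0 < w → w ≤ w₀ →
        (N : ℝ) * w = 2 * π → w ≤ R → R ≤ v →
        (((((Finset.range N) ×ˢ (Finset.range N)).filter fun p : ℕ × ℕ =>
            R / 2 < max |-(bandX μ θ₁ + bandX μ (w / 2 + p.1 * w)) - m₀ * (2 * π)|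
                        |-(bandY μ θ₁ + bandY μ (w / 2 + p.1 * w)) - m₁ * (2 * π)| ∧
            max |-(bandX μ θ₁ + bandX μ (w / 2 + p.1 * w)) - m₀ * (2 * π)|
                |-(bandY μ θ₁ + bandY μ (w / 2 + p.1 * w)) - m₁ * (2 * π)| ≤ R ∧
            |hfun μ θ₁ (w / 2 + p.1 * w) (w / 2 + p.2 * w)| ≤ Cδ * w).card : ℝ)) ≤ K / w := by
  classical
  have hπ := Real.pi_pos
  have hu := B.umin_pos
  obtain ⟨w₀, v, K₁, K₂, hw₀, hv, hK₁, hK₂, hfib⟩ := klfc_exists_fibre_count B hηs hCδ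
  -- shrink `v` so that `√2 v ≤ u_min` (the chord lemma's range)
  obtain ⟨v', hv'⟩ : ∃ x : ℝ, x = min v (B.umin / Real.sqrt 2) := ⟨_, rfl⟩
  have hv'0 : 0 < v' := by rw [hv']; exact lt_min hv (by positivity)
  have hv'1 : v' ≤ v := by rw [hv']; exact min_le_left _ _
  have hv'2 : Real.sqrt 2 * v' ≤ B.umin := by
    have h : v' ≤ B.umin / Real.sqrt 2 := by rw [hv']; exact min_le_right _ _
    rw [le_div_iff₀ (by positivity)] at h; linarith
  refine ⟨w₀, v', (4 * Real.sqrt 2 * π / B.umin + 3) * (2 * K₁), hw₀, hv'0, by positivity, ?_⟩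
  intro μ hlo hhi θ₁ w R N m₀ m₁ hw hww₀ hN hwR hRv
  have hμ' : μ ∈ Icc a b := ⟨by linarith, by linarith⟩
  have hR0 : 0 < R := hw.trans_le hwR
  set fib : ℕ → Finset ℕ := fun n =>
    (Finset.range N).filter fun c : ℕ => |hfun μ θ₁ (w / 2 + n * w) (w / 2 + c * w)| ≤ Cδ * w
    with hfibdef
  set Acl := (Finset.range N).filter fun n : ℕ =>
      R / 2 < max |-(bandX μ θ₁ + bandX μ (w / 2 + n * w)) - m₀ * (2 * π)|
        |-(bandY μ θ₁ + bandY μ (w / 2 + n * w)) - m₁ * (2 * π)| ∧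
      max |-(bandX μ θ₁ + bandX μ (w / 2 + n * w)) - m₀ * (2 * π)|
        |-(bandY μ θ₁ + bandY μ (w / 2 + n * w)) - m₁ * (2 * π)| ≤ R with hAcl
  set P := ((Finset.range N) ×ˢ (Finset.range N)).filter fun p : ℕ × ℕ =>
      R / 2 < max |-(bandX μ θ₁ + bandX μ (w / 2 + p.1 * w)) - m₀ * (2 * π)|
                  |-(bandY μ θ₁ + bandY μ (w / 2 + p.1 * w)) - m₁ * (2 * π)| ∧
      max |-(bandX μ θ₁ + bandX μ (w / 2 + p.1 * w)) - m₀ * (2 * π)|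
          |-(bandY μ θ₁ + bandY μ (w / 2 + p.1 * w)) - m₁ * (2 * π)| ≤ R ∧
      |hfun μ θ₁ (w / 2 + p.1 * w) (w / 2 + p.2 * w)| ≤ Cδ * w with hP
  -- `P ⊆ ⋃_{a ∈ Acl} {a} × fib a`
  have hPsub : P ⊆ Acl.biUnion fun n => (fib n).image fun c => (n, c) := by
    intro p hp
    rw [hP, Finset.mem_filter, Finset.mem_product, Finset.mem_range, Finset.mem_range] at hp
    obtain ⟨⟨hp1, hp2⟩, hR1, hR2, hh⟩ := hp
    rw [Finset.mem_biUnion]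
    refine ⟨p.1, ?_, ?_⟩
    · rw [hAcl, Finset.mem_filter, Finset.mem_range]; exact ⟨hp1, hR1, hR2⟩
    · rw [Finset.mem_image]
      refine ⟨p.2, ?_, rfl⟩
      rw [hfibdef, Finset.mem_filter, Finset.mem_range]; exact ⟨hp2, hh⟩
  have hPcard : (P.card : ℝ) ≤ ∑ n ∈ Acl, ((fib n).card : ℝ) := by
    have h1 := Finset.card_le_card hPsub
    have h2 := Finset.card_biUnion_le (s := Acl) (t := fun n => (fib n).image fun c => (n, c))
    have h3 : ∀ n ∈ Acl, ((fib n).image fun c => (n, c)).card = (fib n).card := fun n _ =>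
      Finset.card_image_of_injective _ (fun c c' h => (Prod.mk.inj h).2)
    rw [Finset.sum_congr rfl h3] at h2
    exact_mod_cast h1.trans h2
  -- each fibre in the class: `≤ K₁/|W - 2πm|_∞ ≤ 2K₁/R`
  have hfibre : ∀ n ∈ Acl, ((fib n).card : ℝ) ≤ 2 * K₁ / R := by
    intro n hn
    rw [hAcl, Finset.mem_filter] at hn
    obtain ⟨-, hR1, hR2⟩ := hn
    have hT0 : 0 < max |-(bandX μ θ₁ + bandX μ (w / 2 + n * w)) - m₀ * (2 * π)|
        |-(bandY μ θ₁ + bandY μ (w / 2 + n * w)) - m₁ * (2 * π)| := by linarith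
    obtain ⟨hC, -⟩ := hfib μ hlo hhi θ₁ (w / 2 + n * w) w N hw hww₀ hN
    have h := hC m₀ m₁ hT0 (hR2.trans (hRv.trans hv'1))
    have h' : K₁ / max |-(bandX μ θ₁ + bandX μ (w / 2 + n * w)) - m₀ * (2 * π)|
        |-(bandY μ θ₁ + bandY μ (w / 2 + n * w)) - m₁ * (2 * π)| ≤ 2 * K₁ / R := by
      rw [div_le_div_iff₀ hT0 hR0]; nlinarith
    exact h.trans h'
  -- the class has `≤ 4√2π R/(u_min w) + 3` members (all within sup-distance `R` of `-p(θ₁) - 2πm`)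
  have hAcl_card : (Acl.card : ℝ) ≤ 4 * Real.sqrt 2 * π * R / (B.umin * w) + 3 := by
    have hsub : Acl ⊆ (Finset.range N).filter fun n : ℕ =>
        max |bandX μ (w / 2 + n * w) - (-bandX μ θ₁ - m₀ * (2 * π))|
            |bandY μ (w / 2 + n * w) - (-bandY μ θ₁ - m₁ * (2 * π))| ≤ R := by
      intro n hn
      rw [hAcl, Finset.mem_filter] at hn
      obtain ⟨hnN, -, hR2⟩ := hn
      rw [Finset.mem_filter]
      refine ⟨hnN, ?_⟩
      have e1 : bandX μ (w / 2 + n * w) - (-bandX μ θ₁ - m₀ * (2 * π)) =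
          -(-(bandX μ θ₁ + bandX μ (w / 2 + n * w)) - m₀ * (2 * π)) := by ring
      have e2 : bandY μ (w / 2 + n * w) - (-bandY μ θ₁ - m₁ * (2 * π)) =
          -(-(bandY μ θ₁ + bandY μ (w / 2 + n * w)) - m₁ * (2 * π)) := by ring
      rw [e1, e2, abs_neg, abs_neg]
      exact hR2
    have h1 := Finset.card_le_card hsub
    have h2 := klgc_card_grid_near_point_le B hμ' (Q₁ := -bandX μ θ₁ - m₀ * (2 * π))
      (Q₂ := -bandY μ θ₁ - m₁ * (2 * π)) hw hN hR0.le
      (by nlinarith [hRv, hv'2, Real.sqrt_nonneg 2])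
    exact le_trans (by exact_mod_cast h1) h2
  -- assemble
  have hsum : ∑ n ∈ Acl, ((fib n).card : ℝ) ≤ Acl.card * (2 * K₁ / R) := by
    have := Finset.sum_le_sum hfibre
    rwa [Finset.sum_const, nsmul_eq_mul] at this
  have hfinal : (Acl.card : ℝ) * (2 * K₁ / R) ≤ (4 * Real.sqrt 2 * π / B.umin + 3) * (2 * K₁) / w := by
    have h1 : (Acl.card : ℝ) * (2 * K₁ / R) ≤
        (4 * Real.sqrt 2 * π * R / (B.umin * w) + 3) * (2 * K₁ / R) :=
      mul_le_mul_of_nonneg_right hAcl_card (by positivity)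
    have hu' := hu.ne'
    have hw' := hw.ne'
    have hR' := hR0.ne'
    have h2a : 4 * Real.sqrt 2 * π * R / (B.umin * w) * (2 * K₁ / R) =
        4 * Real.sqrt 2 * π / B.umin * (2 * K₁) / w := by
      field_simp
    have h2 : (4 * Real.sqrt 2 * π * R / (B.umin * w) + 3) * (2 * K₁ / R) =
        4 * Real.sqrt 2 * π / B.umin * (2 * K₁) / w + 3 * (2 * K₁) / R := by
      rw [add_mul, h2a, ← mul_div_assoc]
    have h3 : 3 * (2 * K₁) / R ≤ 3 * (2 * K₁) / w :=
      div_le_div_of_nonneg_left (by positivity) hw hwR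
    have h4 : (4 * Real.sqrt 2 * π / B.umin + 3) * (2 * K₁) / w =
        4 * Real.sqrt 2 * π / B.umin * (2 * K₁) / w + 3 * (2 * K₁) / w := by ring
    rw [h4]; linarith
  exact hPcard.trans (hsum.trans hfinal)

end Main

end Summit.HubbardSuperconductivity.HubbardSuperconductivity.Theorems

end
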